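import Literature.MathematicalPhysics.KineticTheory.HardSphereEuler
import HarnessLib

/-!
# A wild weight on `𝕋³`: nowhere locally integrable, with integrable logarithm

Stub `P1` of the refutation line of the crux `AnnealedZeroHorizon.MeanSecondLaw`
(stmt-AtomisticToContinuum-9257): there is a measurable `g ≥ 1` on the flat unit torus
`T3 = UnitAddTorus (Fin 3)` which is integrable on NO nonempty open set, yet `log g ∈ L¹(volume)`.

Construction (elementary; sup metric `d` on `T3`, every coordinate circle has diameter `1/2`):
* the profile `d(x,p)⁻²` is integrable (`3 > 2`): dyadically, on `{2^{-m-1} < d ≤ 2^{-m}}` it is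
  `≤ 4^{m+1}` and `closedBall p 2^{-m}` has volume `≤ (2·2^{-m})³`, so `∫ d⁻² ≤ Σₘ 32·2^{-m} = 64`;
* the series `S x = Σₙ 2^{-n} d(x,qₙ)⁻²` (valued in `ℝ≥0∞`) over a dense sequence `q` has finite
  integral, hence is finite a.e. and `toReal ∘ S ∈ L¹`;
* the weight `g x = (1 + (S x).toReal)²` is measurable, `≥ 1`, and `log g = 2 log (1 + s) ≤ 2 s`
  is integrable, while a.e. `g ≥ s² ≥ 4^{-n} d(x,qₙ)⁻⁴` and `d⁻⁴` is NOT integrable near `qₙ`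
  (`∫_{closedBall qₙ ρ} d⁻⁴ ≥ ρ⁻⁴ · (2ρ)³ = 8/ρ → ∞`); every nonempty open set contains such balls.

No new definitions: the profile, the series and the weight are written out explicitly, and the
weight-level lemmas are stated for an arbitrary `S : T3 → ℝ≥0∞`.
-/

noncomputable section

namespace Summit.AtomisticToContinuum.HydrodynamicLimit.Theorems.MeanSecondLawRefutation

open MeasureTheory Filter Set Topology
open scoped ENNReal
open Literature.MathematicalPhysics.KineticTheory

namespace WildWeight

/-! ### Geometry of the flat torus `T3` (sup metric, Haar probability measure) -/

/-- Two points of `T3` are at (sup-)distance at most `1/2`. -/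
theorem dist_le_half (x p : T3) : dist x p ≤ 2⁻¹ := by
  refine (dist_pi_le_iff (by norm_num)).2 fun i => ?_
  rw [dist_eq_norm]
  have := AddCircle.norm_le_half_period (1:ℝ) (x := x i - p i) one_ne_zero
  simpa using this

/-- Volume of a closed ball of `T3`: the cube of `min 1 (2r)`. -/
theorem volume_closedBall (x : T3) {r : ℝ} (hr : 0 ≤ r) :
    volume (Metric.closedBall x r) = ENNReal.ofReal (min 1 (2 * r)) ^ 3 := by
  rw [volume_pi_closedBall _ hr]
  simp [AddCircle.volume_closedBall, Finset.prod_const]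

/-- Upper bound `volume (closedBall x r) ≤ (2r)³`. -/
theorem volume_closedBall_le (x : T3) {r : ℝ} (hr : 0 ≤ r) :
    volume (Metric.closedBall x r) ≤ ENNReal.ofReal ((2 * r) ^ 3) := by
  rw [volume_closedBall x hr, ENNReal.ofReal_pow (by positivity)]
  gcongr
  exact min_le_right _ _

/-- Small closed balls have volume exactly `(2r)³`. -/
theorem volume_closedBall_of_le (x : T3) {r : ℝ} (hr : 0 ≤ r) (hr2 : r ≤ 2⁻¹) :
    volume (Metric.closedBall x r) = ENNReal.ofReal ((2 * r) ^ 3) := by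
  rw [volume_closedBall x hr, ENNReal.ofReal_pow (by positivity), min_eq_right (by linarith)]

/-- Points are null sets of `T3`. -/
theorem volume_singleton (p : T3) : volume ({p} : Set T3) = 0 := by
  rw [← Metric.closedBall_zero, volume_closedBall p le_rfl]
  simp

/-! ### The singular profile `d(x,p)⁻²` -/

/-- The profile `x ↦ d(x,p)⁻²` is measurable. -/
theorem measurable_profile (p : T3) : Measurable fun x : T3 => (dist x p ^ 2)⁻¹ := by
  fun_prop

/-- Pointwise dyadic majorant: `d(x,p)⁻² ≤ Σₘ 4^{m+1} 𝟙[d(x,p) ≤ 2⁻ᵐ]`. -/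
theorem ofReal_profile_le_tsum (p x : T3) :
    ENNReal.ofReal ((dist x p ^ 2)⁻¹) ≤
      ∑' m : ℕ, (Metric.closedBall p ((2:ℝ)⁻¹ ^ m)).indicator
        (fun _ => ENNReal.ofReal ((((2:ℝ)⁻¹ ^ (m + 1)) ^ 2)⁻¹)) x := by
  rcases (dist_nonneg : 0 ≤ dist x p).eq_or_lt with hd | hd
  · simp [← hd]
  · obtain ⟨m, hm1, hm2⟩ := exists_nat_pow_near_of_lt_one hd
      ((dist_le_half x p).trans (by norm_num)) (by norm_num : (0:ℝ) < 2⁻¹) (by norm_num)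
    refine le_trans ?_ (ENNReal.le_tsum m)
    rw [indicator_of_mem (Metric.mem_closedBall.2 hm2)]
    exact ENNReal.ofReal_le_ofReal (inv_anti₀ (by positivity) (by gcongr))

/-- The profile has integral at most `64`, uniformly in the centre. -/
theorem lintegral_profile_le (p : T3) :
    ∫⁻ x, ENNReal.ofReal ((dist x p ^ 2)⁻¹) ≤ ENNReal.ofReal 64 := by
  have hsum : Summable fun m : ℕ => (32:ℝ) * 2⁻¹ ^ m :=
    (summable_geometric_of_lt_one (by norm_num) (by norm_num)).mul_left 32
  calc ∫⁻ x, ENNReal.ofReal ((dist x p ^ 2)⁻¹)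
      ≤ ∫⁻ x, ∑' m : ℕ, (Metric.closedBall p ((2:ℝ)⁻¹ ^ m)).indicator
          (fun _ => ENNReal.ofReal ((((2:ℝ)⁻¹ ^ (m + 1)) ^ 2)⁻¹)) x :=
        lintegral_mono (ofReal_profile_le_tsum p)
    _ = ∑' m : ℕ, ∫⁻ x, (Metric.closedBall p ((2:ℝ)⁻¹ ^ m)).indicator
          (fun _ => ENNReal.ofReal ((((2:ℝ)⁻¹ ^ (m + 1)) ^ 2)⁻¹)) x :=
        lintegral_tsum fun m => (measurable_const.indicator measurableSet_closedBall).aemeasurable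
    _ = ∑' m : ℕ, ENNReal.ofReal ((((2:ℝ)⁻¹ ^ (m + 1)) ^ 2)⁻¹) *
          volume (Metric.closedBall p ((2:ℝ)⁻¹ ^ m)) := by
        simp_rw [lintegral_indicator_const measurableSet_closedBall]
    _ ≤ ∑' m : ℕ, ENNReal.ofReal ((((2:ℝ)⁻¹ ^ (m + 1)) ^ 2)⁻¹) *
          ENNReal.ofReal ((2 * 2⁻¹ ^ m) ^ 3) :=
        ENNReal.tsum_le_tsum fun m => by
          gcongr
          exact volume_closedBall_le p (by positivity)
    _ = ∑' m : ℕ, ENNReal.ofReal ((32:ℝ) * 2⁻¹ ^ m) := by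
        refine tsum_congr fun m => ?_
        rw [← ENNReal.ofReal_mul (by positivity)]
        congr 1
        field_simp
        ring
    _ = ENNReal.ofReal (∑' m : ℕ, (32:ℝ) * 2⁻¹ ^ m) :=
        (ENNReal.ofReal_tsum_of_nonneg (fun m => by positivity) hsum).symm
    _ = ENNReal.ofReal 64 := by
        rw [tsum_mul_left, tsum_geometric_inv_two]; norm_num

/-! ### The dyadic series `Σₙ 2⁻ⁿ d(x,qₙ)⁻²` over a sequence of centres -/

/-- The series is measurable. -/
theorem measurable_series (q : ℕ → T3) :
    Measurable fun x => ∑' n : ℕ, (2:ℝ≥0∞)⁻¹ ^ n * ENNReal.ofReal ((dist x (q n) ^ 2)⁻¹) :=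
  Measurable.tsum fun n => (measurable_profile (q n)).ennreal_ofReal.const_mul _

/-- The series has finite integral (`≤ 2 · 64`). -/
theorem lintegral_series_ne_top (q : ℕ → T3) :
    ∫⁻ x, ∑' n : ℕ, (2:ℝ≥0∞)⁻¹ ^ n * ENNReal.ofReal ((dist x (q n) ^ 2)⁻¹) ≠ ⊤ := by
  rw [lintegral_tsum fun n => ((measurable_profile (q n)).ennreal_ofReal.const_mul _).aemeasurable]
  simp_rw [lintegral_const_mul _ (measurable_profile _).ennreal_ofReal]
  refine ne_top_of_le_ne_top (b := ∑' n : ℕ, (2:ℝ≥0∞)⁻¹ ^ n * ENNReal.ofReal 64) ?_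
    (ENNReal.tsum_le_tsum fun n => by
      gcongr
      exact lintegral_profile_le (q n))
  rw [ENNReal.tsum_mul_right, ENNReal.tsum_geometric, ENNReal.one_sub_inv_two, inv_inv]
  exact ENNReal.mul_ne_top ENNReal.ofNat_ne_top ENNReal.ofReal_ne_top

/-- Each term is dominated by the value of the series where the latter is finite. -/
theorem term_le_series_toReal (q : ℕ → T3) (n : ℕ) {x : T3}
    (hx : ∑' k : ℕ, (2:ℝ≥0∞)⁻¹ ^ k * ENNReal.ofReal ((dist x (q k) ^ 2)⁻¹) < ⊤) :
    2⁻¹ ^ n * (dist x (q n) ^ 2)⁻¹ ≤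
      (∑' k : ℕ, (2:ℝ≥0∞)⁻¹ ^ k * ENNReal.ofReal ((dist x (q k) ^ 2)⁻¹)).toReal := by
  have h : (2:ℝ≥0∞)⁻¹ ^ n * ENNReal.ofReal ((dist x (q n) ^ 2)⁻¹) ≤
      ∑' k : ℕ, (2:ℝ≥0∞)⁻¹ ^ k * ENNReal.ofReal ((dist x (q k) ^ 2)⁻¹) := ENNReal.le_tsum n
  have h0 : 0 ≤ (dist x (q n) ^ 2)⁻¹ := by positivity
  have := ENNReal.toReal_mono hx.ne h
  simpa [ENNReal.toReal_mul, ENNReal.toReal_ofReal h0] using this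

/-! ### The weight `(1 + S)²` of a nonnegative extended-real function `S` -/

/-- The weight is measurable. -/
theorem measurable_weight {S : T3 → ℝ≥0∞} (hS : Measurable S) :
    Measurable fun x => (1 + (S x).toReal) ^ 2 :=
  (hS.ennreal_toReal.const_add 1).pow_const 2

/-- The weight is at least `1`. -/
theorem one_le_weight (S : T3 → ℝ≥0∞) (x : T3) : 1 ≤ (1 + (S x).toReal) ^ 2 :=
  one_le_pow₀ (le_add_of_nonneg_right ENNReal.toReal_nonneg)

/-- `log (1 + s)² ≤ 2 s`. -/
theorem log_weight_le (S : T3 → ℝ≥0∞) (x : T3) :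
    Real.log ((1 + (S x).toReal) ^ 2) ≤ 2 * (S x).toReal := by
  rw [Real.log_pow]
  have h0 : 0 ≤ (S x).toReal := ENNReal.toReal_nonneg
  have := Real.log_le_sub_one_of_pos (by positivity : 0 < 1 + (S x).toReal)
  push_cast
  linarith

/-- If `S` has finite integral, the logarithm of the weight is integrable. -/
theorem integrable_log_weight {S : T3 → ℝ≥0∞} (hS : Measurable S) (hfin : ∫⁻ x, S x ≠ ⊤) :
    Integrable (fun x => Real.log ((1 + (S x).toReal) ^ 2)) := by
  have hG : Integrable (fun x => (S x).toReal) :=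
    integrable_toReal_of_lintegral_ne_top hS.aemeasurable hfin
  refine (hG.const_mul 2).mono'
    (Real.measurable_log.comp (measurable_weight hS)).aestronglyMeasurable (ae_of_all _ fun x => ?_)
  rw [Real.norm_eq_abs, abs_of_nonneg (Real.log_nonneg (one_le_weight S x))]
  exact log_weight_le S x

/-- Lower bound near a centre `p`: if `c · d(x,p)⁻² ≤ S x < ∞` then `(c ρ⁻²)² ≤ (1 + S x)²` on the
punctured ball `0 < d(x,p) ≤ ρ`. -/
theorem sq_le_weight {S : T3 → ℝ≥0∞} {p x : T3} {c ρ : ℝ} (hc : 0 ≤ c)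
    (hle : c * (dist x p ^ 2)⁻¹ ≤ (S x).toReal) (hne : x ≠ p) (hρ : dist x p ≤ ρ) :
    (c * (ρ ^ 2)⁻¹) ^ 2 ≤ (1 + (S x).toReal) ^ 2 := by
  have hd : 0 < dist x p := dist_pos.2 hne
  have hρ0 : 0 < ρ := hd.trans_le hρ
  have h2 : (ρ ^ 2)⁻¹ ≤ (dist x p ^ 2)⁻¹ := inv_anti₀ (by positivity) (by gcongr)
  have h0 : 0 ≤ (S x).toReal := ENNReal.toReal_nonneg
  calc (c * (ρ ^ 2)⁻¹) ^ 2 ≤ (c * (dist x p ^ 2)⁻¹) ^ 2 := by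
        have : 0 ≤ (ρ ^ 2)⁻¹ := by positivity
        gcongr
    _ ≤ (S x).toReal ^ 2 := by
        have : 0 ≤ c * (dist x p ^ 2)⁻¹ := by positivity
        gcongr
    _ ≤ (1 + (S x).toReal) ^ 2 := by gcongr; linarith

/-- If `S` is measurable with finite integral and dominates `2⁻ⁿ d(·,qₙ)⁻²` (where finite) along a
dense sequence `q`, then the weight `(1 + S)²` is integrable on no nonempty open set. -/
theorem not_integrableOn_weight {S : T3 → ℝ≥0∞} (hS : Measurable S) (hfin : ∫⁻ x, S x ≠ ⊤)
    {q : ℕ → T3} (hq : DenseRange q)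
    (hle : ∀ n x, S x < ⊤ → 2⁻¹ ^ n * (dist x (q n) ^ 2)⁻¹ ≤ (S x).toReal)
    {U : Set T3} (hU : IsOpen U) (hne : U.Nonempty) :
    ¬ IntegrableOn (fun x => (1 + (S x).toReal) ^ 2) U := by
  intro hint
  obtain ⟨n, hn⟩ := hq.exists_mem_open hU hne
  obtain ⟨ε, hε, hball⟩ := Metric.nhds_basis_closedBall.mem_iff.1 (hU.mem_nhds hn)
  have hI : ∫⁻ x in U, ENNReal.ofReal ((1 + (S x).toReal) ^ 2) < ⊤ :=
    hint.integrable.lintegral_lt_top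
  set I := ∫⁻ x in U, ENNReal.ofReal ((1 + (S x).toReal) ^ 2)
  have hpt : ∀ᵐ x, x ≠ q n := by
    filter_upwards [measure_eq_zero_iff_ae_notMem.1 (volume_singleton (q n))] with x hx
    simpa using hx
  have hlt : ∀ᵐ x, S x < ⊤ := ae_lt_top hS hfin
  set K : ℝ := 8 * ((2:ℝ)⁻¹ ^ n) ^ 2 with hK
  have hK0 : 0 < K := by positivity
  -- the key lower bound on small balls inside `U`
  have key : ∀ ρ : ℝ, 0 < ρ → ρ ≤ 2⁻¹ → ρ ≤ ε → K / ρ ≤ I.toReal := by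
    intro ρ hρ hρ2 hρε
    have hsub : Metric.closedBall (q n) ρ ⊆ U :=
      (Metric.closedBall_subset_closedBall hρε).trans hball
    have hae : ∀ᵐ x ∂(volume.restrict (Metric.closedBall (q n) ρ)),
        ENNReal.ofReal ((2⁻¹ ^ n * (ρ ^ 2)⁻¹) ^ 2) ≤ ENNReal.ofReal ((1 + (S x).toReal) ^ 2) := by
      filter_upwards [ae_restrict_mem measurableSet_closedBall, ae_restrict_of_ae hlt,
        ae_restrict_of_ae hpt] with x hx hfx hxne
      exact ENNReal.ofReal_le_ofReal
        (sq_le_weight (by positivity) (hle n x hfx) hxne (Metric.mem_closedBall.1 hx))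
    rw [← ENNReal.ofReal_le_iff_le_toReal hI.ne]
    calc ENNReal.ofReal (K / ρ)
        = ENNReal.ofReal ((2⁻¹ ^ n * (ρ ^ 2)⁻¹) ^ 2) * ENNReal.ofReal ((2 * ρ) ^ 3) := by
          rw [← ENNReal.ofReal_mul (by positivity)]
          congr 1
          rw [hK]
          field_simp
          ring
      _ = ∫⁻ _ in Metric.closedBall (q n) ρ, ENNReal.ofReal ((2⁻¹ ^ n * (ρ ^ 2)⁻¹) ^ 2) := by
          rw [setLIntegral_const, volume_closedBall_of_le (q n) hρ.le hρ2]
      _ ≤ ∫⁻ x in Metric.closedBall (q n) ρ, ENNReal.ofReal ((1 + (S x).toReal) ^ 2) :=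
          lintegral_mono_ae hae
      _ ≤ I := lintegral_mono_set hsub
  -- choose `ρ` so small that `K / ρ > I.toReal`
  set ρ : ℝ := min (min ε 2⁻¹) (K / (I.toReal + 1))
  have hρ0 : 0 < ρ := lt_min (lt_min hε (by norm_num)) (by positivity)
  have h1 := key ρ hρ0 ((min_le_left _ _).trans (min_le_right _ _))
    ((min_le_left _ _).trans (min_le_left _ _))
  have h2 : ρ * (I.toReal + 1) ≤ K := (le_div_iff₀ (by positivity)).1 (min_le_right _ _)
  have h3 : I.toReal + 1 ≤ K / ρ := by
    rw [le_div_iff₀ hρ0]; linarith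
  linarith

end WildWeight

/-- **A wild weight on `𝕋³`.** There is a measurable `g ≥ 1` on `𝕋³` which is integrable on NO
nonempty open set, yet has `log g ∈ L¹`: `g = (1 + Σₙ 2⁻ⁿ d(x,qₙ)⁻²)²` for a dense sequence `qₙ`
(`d⁻²` is integrable in dimension `3`, `d⁻⁴` is not; `log (1+s)² ≤ 2s`). [folklore] -/
theorem exists_wildWeight :
    ∃ g : T3 → ℝ, Measurable g ∧ (∀ x, 1 ≤ g x) ∧
      (∀ U : Set T3, IsOpen U → U.Nonempty → ¬ IntegrableOn g U) ∧
      Integrable (fun x => Real.log (g x)) := by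
  obtain ⟨q, hq⟩ := TopologicalSpace.exists_dense_seq T3
  exact ⟨fun x => (1 + (∑' n : ℕ, (2:ℝ≥0∞)⁻¹ ^ n * ENNReal.ofReal ((dist x (q n) ^ 2)⁻¹)).toReal) ^ 2,
    WildWeight.measurable_weight (WildWeight.measurable_series q), WildWeight.one_le_weight _,
    fun U hU hne => WildWeight.not_integrableOn_weight (WildWeight.measurable_series q)
      (WildWeight.lintegral_series_ne_top q) hq
      (fun n x hx => WildWeight.term_le_series_toReal q n hx) hU hne,
    WildWeight.integrable_log_weight (WildWeight.measurable_series q)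
      (WildWeight.lintegral_series_ne_top q)⟩

end Summit.AtomisticToContinuum.HydrodynamicLimit.Theorems.MeanSecondLawRefutation
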